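import Summits.BirchSwinnertonDyer.BirchSwinnertonDyer.Theorems.ManinLocalTwoThreeTameTwoKummerBlind
import Summits.BirchSwinnertonDyer.BirchSwinnertonDyer.Theorems.ManinLocalTwoThreeNoDoublingIVstarFourP
import Summits.BirchSwinnertonDyer.Rank1Residual.ManinAdditive.OddDegreeTooth
import Literature.NumberTheory.EllipticCurves.CuspFormLFunctionLevelConductorProofs
import HarnessLib

/-!
# The totally blind tame curves are exactly the tame `IV*` curves with a rational `2`-torsion point: the C2 stub
# `BlindTameOptimalOddDegree` (E-an-73) is EQUIVALENT to its `IV*` restatement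

Summit `BirchSwinnertonDyer`, route `ManinLocalTwoThree` (cell bsd-f2-manin), deciding crux C2 `ManinOddAtFour`
(stmt-BirchSwinnertonDyer-22967); the lead's C2 skeleton `kato_shift_two` carries `stub_blindTameOptimalOddDegree` BY NAME
(`…ManinAdditive.OddDegreeTooth.BlindTameOptimalOddDegree`: an `X₀(N)`-optimal globally minimal `W = [0, a₂, 0, a₄, a₆]` with `4 ∥ N`,
a rational `2`-torsion point and ALL rational `2`-torsion Kummer-blind has ODD modular degree).  By p648738 (`…TameTwoKummerBlind`):
at `ord₂ Δ_min = 4` no rational `2`-torsion point is blind, at `ord₂ Δ_min = 8` all are; and `4 ∥ N` forces `ord₂ Δ_min ∈ {4, 8}`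
(`padicValInt_minimalDiscriminantInt_eq_four_or_eight_of_tame_two`).  Hence:

* `padicValInt_minimalDiscriminantInt_eq_eight_of_allRationalTwoTorsionBlind` — a tame `[0, a₂, 0, a₄, a₆]` curve with a rational
  `2`-torsion point, all of them blind, is of type `IV*` (`ord₂ Δ_min = 8`); and conversely (`allRationalTwoTorsionBlind_of_IVstar`).
* `blindTameOptimalOddDegree_iff_IVstar` — granted the Modularity Theorem `exists_isNewformOf` (the crux's hypothesis, to read `4 ∥ N`
  on the conductor), `BlindTameOptimalOddDegree` ⟺ «every `X₀(N)`-optimal `[0, a₂, 0, a₄, a₆]` curve with `4 ∥ N`, `ord₂ Δ_min = 8` and a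
  rational `2`-torsion point has odd modular degree» — the stub is a statement about the tame `IV*` stratum only (an's 55 classes
  `N = 4(m² + 4)` are of this type).

HONEST FRAMING: the stub is NOT proved (modular-degree parity is global); C2, Manin's conjecture and BSD are not proved.  No definitions,
no named facts, no sorry.  References: [SilvermanATAEC1994] IV.9.4 Table 4.1; [Yazdani2009] Thm. 3.8; [DiamondShurman2005] Thm. 8.8.1;
HOME/MEMO-an.md §56, §67 (E-an-50, E-an-73).
-/

set_option autoImplicit false
set_option linter.dupNamespace false

noncomputable section

open scoped Classical
open WeierstrassCurve Literature.NumberTheory.EllipticCurves Literature.NumberTheory.EllipticCurves.ModularForms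
open CongruenceSubgroup Polynomial
open Summit.BirchSwinnertonDyer.Rank1Residual.ManinAdditive.CuspidalKummer
open Summit.BirchSwinnertonDyer.Rank1Residual.ManinAdditive.ShimuraLedger
open Summit.BirchSwinnertonDyer.Rank1Residual.ManinAdditive.OddDegreeTooth

namespace Summit.BirchSwinnertonDyer.BirchSwinnertonDyer.Theorems.ManinLocalTwoThree

/-- **Totally blind + tame ⟹ `IV*`:** a globally minimal `W = [0, a₂, 0, a₄, a₆]` with `4 ∥ N(W)`, a rational `2`-torsion point and every
rational `2`-torsion point Kummer-blind has `ord₂ Δ_min = 8`. [cite: SilvermanATAEC1994, IV.9.4 Table 4.1] -/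
theorem padicValInt_minimalDiscriminantInt_eq_eight_of_allRationalTwoTorsionBlind (W : WeierstrassCurve ℚ) [W.IsElliptic]
    [W.IsGloballyMinimal] (ha₁ : W.a₁ = 0) (ha₃ : W.a₃ = 0) (h4 : 2 ^ 2 ∣ W.conductorNorm ℤ) (h8 : ¬ 2 ^ 3 ∣ W.conductorNorm ℤ)
    (hT : HasRationalTwoTorsion W) (hbl : AllRationalTwoTorsionBlind W) : padicValInt 2 W.minimalDiscriminantInt = 8 := by
  rcases padicValInt_minimalDiscriminantInt_eq_four_or_eight_of_tame_two W h4 h8 with h | h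
  · obtain ⟨e, he⟩ := hT
    exact absurd hbl (not_allRationalTwoTorsionBlind_of_IV W ha₁ ha₃ h he)
  · exact h

/-- **Tame: totally blind with a rational `2`-torsion point ⟺ `IV*` with a rational `2`-torsion point.**
[cite: SilvermanATAEC1994, IV.9.4 Table 4.1] -/
theorem allRationalTwoTorsionBlind_iff_padicValInt_eq_eight_of_tame (W : WeierstrassCurve ℚ) [W.IsElliptic] [W.IsGloballyMinimal]
    (ha₁ : W.a₁ = 0) (ha₃ : W.a₃ = 0) (h4 : 2 ^ 2 ∣ W.conductorNorm ℤ) (h8 : ¬ 2 ^ 3 ∣ W.conductorNorm ℤ)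
    (hT : HasRationalTwoTorsion W) : AllRationalTwoTorsionBlind W ↔ padicValInt 2 W.minimalDiscriminantInt = 8 :=
  ⟨padicValInt_minimalDiscriminantInt_eq_eight_of_allRationalTwoTorsionBlind W ha₁ ha₃ h4 h8 hT,
    allRationalTwoTorsionBlind_of_IVstar W ha₁ ha₃ h4 h8⟩

/-- **E-an-73 `BlindTameOptimalOddDegree` ⟺ its `IV*` restatement** (granted `exists_isNewformOf` to read `4 ∥ N` on `N(W)`).
[cite: Yazdani2009, Thm. 3.8] [cite: DiamondShurman2005, Thm. 8.8.1] [cite: SilvermanATAEC1994, IV.9.4 Table 4.1] -/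
theorem blindTameOptimalOddDegree_iff_IVstar (hnf : exists_isNewformOf) :
    BlindTameOptimalOddDegree ↔
      ∀ (W : WeierstrassCurve ℚ) [W.IsElliptic] [W.IsGloballyMinimal] {N : ℕ} [NeZero N] (D : ModularParametrizationData W N),
        (∀ z ∈ D.L.lattice, ∃ w ∈ periodLattice D.f, z = D.c * w) → 2 ^ 2 ∣ N → ¬ 2 ^ 3 ∣ N → W.a₁ = 0 → W.a₃ = 0 →
        HasRationalTwoTorsion W → padicValInt 2 W.minimalDiscriminantInt = 8 → Odd D.deg := by
  constructor
  · intro h W _ _ N _ D hL h4 h8 ha₁ ha₃ hT hΔ8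
    have hN : N = W.conductorNorm ℤ := IsNewformOf.level_eq_conductorNorm_of_exists_isNewformOf hnf D.isNewformOf
    exact h W D hL h4 h8 ha₁ ha₃ hT (allRationalTwoTorsionBlind_of_IVstar W ha₁ ha₃ (hN ▸ h4) (hN ▸ h8) hΔ8)
  · intro h W _ _ N _ D hL h4 h8 ha₁ ha₃ hT hbl
    have hN : N = W.conductorNorm ℤ := IsNewformOf.level_eq_conductorNorm_of_exists_isNewformOf hnf D.isNewformOf
    exact h W D hL h4 h8 ha₁ ha₃ hT
      (padicValInt_minimalDiscriminantInt_eq_eight_of_allRationalTwoTorsionBlind W ha₁ ha₃ (hN ▸ h4) (hN ▸ h8) hT hbl)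

end Summit.BirchSwinnertonDyer.BirchSwinnertonDyer.Theorems.ManinLocalTwoThree

end
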